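import Literature.AnabelianGeometry.SemiGraphs.SemiGraph
import HarnessLib

/-!
# Semi-graphs, §1/§2: the semi-graph of a system of fibres ("covering semi-graph")

Mochizuki, *Semi-graphs of anabelioids*, Publ. RIMS **42** (2006), §2 p. 23
[cite: MochizukiSemiAnbd2006, Def. 2.2(i) p.23]: for a finite étale covering `B(𝒢)_{G'} → B(𝒢)`,
"the underlying semi-graph `𝔾'` of `𝒢'`: the vertices (respectively, edges) of `𝔾'` that lie over a
vertex `v` (respectively, edge `e`) of `𝔾` correspond to the connected components of `S_v`
(respectively, `T_e`); a branch of such an edge abuts to the vertex given by the component under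
which its component lies (via the gluing isomorphism)".  This file isolates the purely
combinatorial part of that construction (brick B3 of the existence half of Def. 2.2 (i)):

* `SemiGraph.FibreData G` — a type of "components" over each vertex and each edge, and for each
  branch `b` of `e` abutting to `v` a map from the components over `e` to the components over `v`;
* `SemiGraph.FibreData.total` — the resulting semi-graph `𝔾'` (vertices `Σ v, F v`, edges
  `Σ e, F e`, branches `Σ b, F (edgeOf b)`), with its projection `proj : 𝔾' ⟶ 𝔾`;
* `SemiGraph.FibreData.isProper_proj` — the projection is proper (preserves verticial
  cardinalities), the clause required by `IsFiniteEtaleCoveringOf`; and the fibre of `proj` over a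
  vertex `v` / an edge `e` is `F v` / `F e` (`fibreVertexEquiv`, `fibreEdgeEquiv`).

The anabelioid layer (constituents `(𝒢_v)_P`, exact pull-backs) is deliberately NOT here.
-/

namespace Literature.AnabelianGeometry.SemiGraphs

open CategoryTheory

universe u

namespace SemiGraph

variable (G : SemiGraph.{u})

/-- Fibre data over a semi-graph: components over vertices and over edges, and for each branch
abutting to a vertex the specialisation of edge-components to vertex-components ([SemiAnbd]
p. 23: the component of `T_e` lies under a unique component of `S_v` via `ψ_b`).
[cite: MochizukiSemiAnbd2006, Def. 2.2(i) p.23] -/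
structure FibreData : Type (u + 1) where
  /-- the components over a vertex -/
  FV : G.Vertex → Type u
  /-- the components over an edge -/
  FE : G.Edge → Type u
  /-- for a branch `b` abutting to `v`, the component over `v` under which a component over the
  edge of `b` lies -/
  σ : ∀ (b : G.Branch) (v : G.Vertex), G.abuts b = some v → FE (G.edgeOf b) → FV v

namespace FibreData

variable {G} (D : G.FibreData)

/-- The *total semi-graph* `𝔾'` of fibre data: vertices and edges are the components, a branch of
the edge `(e, c)` is a branch `b` of `e` decorated by `c`, abutting to `(v, σ_b c)` when `b` abuts
to `v`. [cite: MochizukiSemiAnbd2006, Def. 2.2(i) p.23] -/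
def total : SemiGraph.{u} where
  Vertex := Σ v : G.Vertex, D.FV v
  Edge := Σ e : G.Edge, D.FE e
  Branch := Σ b : G.Branch, D.FE (G.edgeOf b)
  edgeOf bc := ⟨G.edgeOf bc.1, bc.2⟩
  abuts bc := (G.abuts bc.1).pbind fun v hv => some ⟨v, D.σ bc.1 v (Option.mem_def.mp hv) bc.2⟩
  two_branches ec := by
    obtain ⟨e, c⟩ := ec
    obtain ⟨b₁, b₂, hne, h₁, h₂, hall⟩ := G.two_branches e
    subst h₁
    refine ⟨⟨b₁, c⟩, ⟨b₂, cast (congrArg D.FE h₂.symm) c⟩, fun h => hne (congrArg Sigma.fst h),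
      rfl, ?_, fun bc hbc => ?_⟩
    · -- `edgeOf ⟨b₂, cast c⟩ = ⟨edgeOf b₁, c⟩`
      ext
      · exact h₂
      · exact cast_heq _ _
    · obtain ⟨b, c'⟩ := bc
      have he : G.edgeOf b = G.edgeOf b₁ := congrArg Sigma.fst hbc
      have hc : HEq c' c := (Sigma.mk.inj_iff.mp hbc).2
      rcases hall b he with rfl | rfl
      · left
        ext
        · rfl
        · exact hc
      · right
        ext
        · rfl
        · exact hc.trans (cast_heq _ _).symm

/-- The projection `𝔾' ⟶ 𝔾` of the total semi-graph. [cite: MochizukiSemiAnbd2006, Def. 2.2(i) p.23] -/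
def proj : D.total ⟶ G where
  vertexMap := Sigma.fst
  edgeMap := Sigma.fst
  branchMap := Sigma.fst
  edgeOf_branchMap _ := rfl
  branchMap_injOn bc₁ bc₂ he hb := by
    obtain ⟨b₁, c₁⟩ := bc₁
    obtain ⟨b₂, c₂⟩ := bc₂
    change b₁ = b₂ at hb
    subst hb
    have hc : HEq c₁ c₂ := (Sigma.mk.inj_iff.mp he).2
    exact Sigma.ext rfl hc
  abuts_branchMap bc vc h := by
    obtain ⟨b, c⟩ := bc
    change (G.abuts b).pbind _ = some vc at h
    cases hb : G.abuts b with
    | none => simp [hb] at h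
    | some w =>
      simp only [hb, Option.pbind_some] at h
      cases h
      rfl

/-- The projection on vertices / edges / branches is the first projection.
[cite: MochizukiSemiAnbd2006, Def. 2.2(i) p.23] -/
@[simp] theorem proj_vertexMap (vc : D.total.Vertex) : D.proj.vertexMap vc = vc.1 := rfl

/-- See `proj_vertexMap`. [cite: MochizukiSemiAnbd2006, Def. 2.2(i) p.23] -/
@[simp] theorem proj_edgeMap (ec : D.total.Edge) : D.proj.edgeMap ec = ec.1 := rfl

/-- See `proj_vertexMap`. [cite: MochizukiSemiAnbd2006, Def. 2.2(i) p.23] -/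
@[simp] theorem proj_branchMap (bc : D.total.Branch) : D.proj.branchMap bc = bc.1 := rfl

/-- `Option.pbind` with a total `some`-valued function does not change definedness. [folklore] -/
private theorem isSome_pbind_some {α β : Type*} (o : Option α) (f : ∀ a : α, a ∈ o → β) :
    (o.pbind fun a h => some (f a h)).isSome = o.isSome := by
  cases o <;> rfl

/-- A decorated branch abuts to a vertex iff the underlying branch does.
[cite: MochizukiSemiAnbd2006, Def. 2.2(i) p.23] -/
theorem total_abuts_isSome (bc : D.total.Branch) :
    (D.total.abuts bc).isSome = (G.abuts bc.1).isSome := by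
  obtain ⟨b, c⟩ := bc
  exact isSome_pbind_some (G.abuts b) fun v hv =>
    (⟨v, D.σ b v (Option.mem_def.mp hv) c⟩ : Σ v : G.Vertex, D.FV v)

/-- The verticial portion of the edge `(e, c)` of `𝔾'` is in bijection with that of `e`.
[cite: MochizukiSemiAnbd2006, Def. 2.2(i) p.23] -/
theorem vertCard_total (ec : D.total.Edge) : D.total.vertCard ec = G.vertCard ec.1 := by
  obtain ⟨e, c⟩ := ec
  unfold SemiGraph.vertCard
  apply Nat.card_congr
  refine
    { toFun := fun bc => ⟨bc.1.1, ?_⟩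
      invFun := fun b => ⟨⟨b.1, cast (congrArg D.FE b.2.1.symm) c⟩, ?_⟩
      left_inv := ?_
      right_inv := ?_ }
  · obtain ⟨⟨b, c'⟩, h₁, h₂⟩ := bc
    refine ⟨congrArg Sigma.fst h₁, ?_⟩
    rw [← D.total_abuts_isSome ⟨b, c'⟩]
    exact h₂
  · obtain ⟨b, hb, hb'⟩ := b
    refine ⟨?_, ?_⟩
    · change (⟨G.edgeOf b, cast _ c⟩ : Σ e : G.Edge, D.FE e) = ⟨e, c⟩
      ext
      · exact hb
      · exact cast_heq _ _
    · rw [D.total_abuts_isSome]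
      exact hb'
  · rintro ⟨⟨b, c'⟩, h₁, h₂⟩
    have he : G.edgeOf b = e := congrArg Sigma.fst h₁
    have hc : HEq c' c := (Sigma.mk.inj_iff.mp h₁).2
    apply Subtype.ext
    change (⟨b, cast _ c⟩ : Σ b : G.Branch, D.FE (G.edgeOf b)) = ⟨b, c'⟩
    ext
    · rfl
    · exact (cast_heq _ _).trans hc.symm
  · rintro ⟨b, hb, hb'⟩
    rfl

/-- **The projection of the total semi-graph is proper** (it preserves verticial cardinalities),
as required of the base morphism of a finite étale covering ([SemiAnbd] p. 23 "lies over some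
proper morphism of semi-graphs"). [cite: MochizukiSemiAnbd2006, Def. 2.2(i) p.23] -/
theorem isProper_proj : SemiGraph.IsProper D.proj := fun ec => (D.vertCard_total ec).symm

/-- The vertices of `𝔾'` over `v` are the components over `v`.
[cite: MochizukiSemiAnbd2006, Def. 2.2(i) p.23] -/
def fibreVertexEquiv (v : G.Vertex) : {vc : D.total.Vertex // D.proj.vertexMap vc = v} ≃ D.FV v where
  toFun vc := cast (congrArg D.FV vc.2) vc.1.2
  invFun c := ⟨⟨v, c⟩, rfl⟩
  left_inv := by
    rintro ⟨⟨w, c⟩, h⟩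
    change w = v at h
    subst h
    rfl
  right_inv c := rfl

/-- The edges of `𝔾'` over `e` are the components over `e`.
[cite: MochizukiSemiAnbd2006, Def. 2.2(i) p.23] -/
def fibreEdgeEquiv (e : G.Edge) : {ec : D.total.Edge // D.proj.edgeMap ec = e} ≃ D.FE e where
  toFun ec := cast (congrArg D.FE ec.2) ec.1.2
  invFun c := ⟨⟨e, c⟩, rfl⟩
  left_inv := by
    rintro ⟨⟨e', c⟩, h⟩
    change e' = e at h
    subst h
    rfl
  right_inv c := rfl

/-- The map `vc ↦ (proj vc, component)` from the vertices of `𝔾'` to `Σ v, F v` is the identity,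
hence bijective — the vertex clause of `IsFiniteEtaleCoveringOf`.
[cite: MochizukiSemiAnbd2006, Def. 2.2(i) p.23] -/
theorem vertex_sigma_bijective :
    Function.Bijective fun vc : D.total.Vertex => (⟨D.proj.vertexMap vc, vc.2⟩ : Σ v, D.FV v) :=
  ⟨fun _ _ h => h, fun a => ⟨a, rfl⟩⟩

/-- The edge clause of `IsFiniteEtaleCoveringOf` for the total semi-graph: `ec ↦ (proj ec, component)`
is bijective. [cite: MochizukiSemiAnbd2006, Def. 2.2(i) p.23] -/
theorem edge_sigma_bijective :
    Function.Bijective fun ec : D.total.Edge => (⟨D.proj.edgeMap ec, ec.2⟩ : Σ e, D.FE e) :=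
  ⟨fun _ _ h => h, fun a => ⟨a, rfl⟩⟩

end FibreData

end SemiGraph

end Literature.AnabelianGeometry.SemiGraphs
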